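import Literature.NumberTheory.Automorphic.UnramifiedOrbitalUnitFactorPair
import Literature.NumberTheory.Automorphic.CompactCoreLevelConj
import Literature.NumberTheory.Rogawski1990.AdelicStableOrbitalSupportFiniteH
import HarnessLib

/-!
# Mass one at every `H`-MATCHING ADÈLE: canonical local families on the pair `H_v = U(H₂)_v × U(H₁)_v` are normalised off a finite set at every adelic
# conjugate of a normalised point, and at every point of the `H`-adelic stable class `𝒞′_𝐀(γ_H)` of `H = U(Φ₂) × U(Φ₁)`
(Rogawski (1990), §4.3 pp. 43–44: «measures normalised so that `K ∩ T` has measure one for almost all `v`»; Kottwitz (1986) §7, Prop. 7.1)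

Topic `NumberTheory/Automorphic`; namespaces `Literature.NumberTheory.Automorphic.UnitaryGroup` (§1–§2) and `Literature.NumberTheory.Rogawski1990` (§3).
THEOREMS ONLY (no definition, no instance, no named fact, no `sorry`).  Cell `pub/hodgecm-mathlib`, ENGINE T1, ED 1.19c (xiii″) — the `H`-SIDE TWIN («N-H») of ★
F0P3a-p01's `CompactCoreLevelConj` (`exists_isNormalisedOff_matchingAdeleG`): the `H`-side adelic-class-indexed family of the SJ_H socket (★-to-be «C-H»
`ofLocalAdelicH mH mHi`, F0-typ1) is the honest (non-junk) measure at a class `c` only when the local families `mH v` are NORMALISED off a finite set at the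
representative `out c` — `(mH v).atPoint (out c)_v (π (K₂,v × K₁,v)) = 1` for `v ∉ S₀` (the literal of ★ S-H `UnramifiedOrbitalUnitFactorPair` §4, stated
UNFOLDED so the forthcoming `IsNormalisedOffH` bridges by `Iff.rfl`).  ★ S-H `exists_finset_forall_atPoint_pair_eq_one_of_isCanonical` gives this at the RATIONAL
point `((γ₂)_v, (γ₁)_v)`; here it is carried to every adelic conjugate and to every `H`-matching adèle:

* §1 (pair `U(H₂) × U(H₁)`, any `N₂ N₁ H₂ H₁`; `mH v` canonical for `(P_v, ν_v)` with `ν_v(K₂,v × K₁,v) = 1`)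
  **`UnitaryGroup.exists_finset_forall_atPoint_pair_eq_one_of_eventually`** — at ANY pair-adèle `(y₂, y₁)` whose local centralisers have compact core in
  `K₂,v × K₁,v` a.e. (★ `IsCanonical.atPoint_image_mk_eq_one` place by place); **`…_conj`** — hence at every adelic conjugate `(a y₂ a⁻¹, b y₁ b⁻¹)` (`a_v ∈ K₂,v`,
  `b_v ∈ K₁,v` a.e., ★ `compactCore_centralizer_conj_subset` on the product with `K = K₂,v × K₁,v`); **`…_of_isConj_toAdelic`** — hence at every adelic
  conjugate of a rational regular pair (★ S-H `eventually_compactCore_centralizer_pair_subset`, fact-free at hermitian non-degenerate `H₂`, `H₁`).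
* §2 (`H = U(Φ₂) × U(Φ₁)`) **`Rogawski1990.MatchingAdeleH.exists_finset_forall_atPoint_eq_one`** — GIVEN the a.e. `K_v`-conjugacy of [Kt₄] Prop. 7.1 for `U(Φ₂)`
  at `γ₂` (hypothesis `hP`, ★ `AdelicStableOrbitalSupportFiniteH`'s shape), canonical families are normalised off a finite set at EVERY `H`-matching adèle
  `p ∈ 𝒞′_𝐀(γ_H)` over a rational `γ_H = (γ₂, γ₁)` with `γ₂` regular: `p.adele.2 = toAdelic γ₁` (★ `MatchingAdeleH.adele_snd_eq`), `p.adele.1_v = k (γ₂)_v k⁻¹`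
  with `k ∈ K₂,v` a.e., so `compactCore Z(p_v) = (k,1) · compactCore Z((γ_H)_v) · (k,1)⁻¹ ⊆ K₂,v × K₁,v`; and **`…_of_mem_classes`** — at every representative
  `h` of a class of `𝒞′_𝐀(γ_H)` (saturation, ★ `exists_matchingAdeleH_adele_eq_of_mem`), e.g. `h = out c`: the normalisability guard of «C-H» at every class
  the SJ_H Euler socket sums over.

HC_CM is proved only modulo the printed citations until rung 0 closes; this file is unconditional ([Kt₄] enters as the hypothesis `hP`, a theorem by ★
`eventually_forall_integralConj_cmDatum` at `N = 2`).

## References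
* J. D. Rogawski, *Automorphic Representations of Unitary Groups in Three Variables*, Ann. of Math. Stud. 123 (1990), §3.3 p. 21, §4.3 pp. 43–44
  [Rogawski1990].
* R. E. Kottwitz, *Stable trace formula: elliptic singular terms*, Math. Ann. 275 (1986), §7, Prop. 7.1 [Kottwitz1986].
-/

noncomputable section

open MeasureTheory Measure Set NumberField IsDedekindDomain Filter
open Literature.MeasureTheory.Group
open scoped ENNReal NNReal Pointwise Matrix

/-! ## §1 The pair `U(H₂) × U(H₁)`: mass one at adelic points with a.e.-small compact cores, at conjugates, at conjugates of rational pairs -/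

namespace Literature.NumberTheory.Automorphic.UnitaryGroup

open Literature.NumberTheory.Rogawski1990 (IsRegularElt)

variable (L : Type) [Field L] [NumberField L] [IsCMField L] {N₂ N₁ : ℕ}
  (H₂ : Matrix (Fin N₂) (Fin N₂) L) (H₁ : Matrix (Fin N₁) (Fin N₁) L)
  [∀ (v : HeightOneSpectrum (𝓞 ↥(maximalRealSubfield L))) (x : (cmDatum L N₂ H₂).Local v × (cmDatum L N₁ H₁).Local v),
    MeasurableSpace (((cmDatum L N₂ H₂).Local v × (cmDatum L N₁ H₁).Local v) ⧸
      Subgroup.centralizer ({x} : Set ((cmDatum L N₂ H₂).Local v × (cmDatum L N₁ H₁).Local v)))]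
  [∀ (v : HeightOneSpectrum (𝓞 ↥(maximalRealSubfield L))) (x : (cmDatum L N₂ H₂).Local v × (cmDatum L N₁ H₁).Local v),
    BorelSpace (((cmDatum L N₂ H₂).Local v × (cmDatum L N₁ H₁).Local v) ⧸
      Subgroup.centralizer ({x} : Set ((cmDatum L N₂ H₂).Local v × (cmDatum L N₁ H₁).Local v)))]
  [∀ v : HeightOneSpectrum (𝓞 ↥(maximalRealSubfield L)), MeasurableSpace ((cmDatum L N₂ H₂).Local v × (cmDatum L N₁ H₁).Local v)]
  [∀ v : HeightOneSpectrum (𝓞 ↥(maximalRealSubfield L)), BorelSpace ((cmDatum L N₂ H₂).Local v × (cmDatum L N₁ H₁).Local v)]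
  (P : ∀ v : HeightOneSpectrum (𝓞 ↥(maximalRealSubfield L)), (cmDatum L N₂ H₂).Local v × (cmDatum L N₁ H₁).Local v → Prop)
  (νH : ∀ v : HeightOneSpectrum (𝓞 ↥(maximalRealSubfield L)), Measure ((cmDatum L N₂ H₂).Local v × (cmDatum L N₁ H₁).Local v))
  [∀ v, (νH v).IsHaarMeasure] [∀ v, (νH v).IsMulRightInvariant]
  (mH : ∀ v : HeightOneSpectrum (𝓞 ↥(maximalRealSubfield L)), OrbitalMeasureFamily ((cmDatum L N₂ H₂).Local v × (cmDatum L N₁ H₁).Local v))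

/-- **Mass one off a finite set at ANY pair-adèle with a.e.-small compact cores**: local families `mH v` on `U(H₂)_v × U(H₁)_v` canonical for `(P_v, ν_v)`,
`ν_v(K₂,v × K₁,v) = 1`; a pair-adèle `(y₂, y₁)` with `P_v` at its local class representatives and `compactCore Z((y₂)_v, (y₁)_v) ⊆ K₂,v × K₁,v` for almost all `v`
has `(mH v).atPoint ((y₂)_v, (y₁)_v) (π (K₂,v × K₁,v)) = 1` for every `v` off a finite `S₀` (★ `IsCanonical.atPoint_image_mk_eq_one` place by place; the point need NOT be
rational).  The conclusion is the UNFOLDED `IsNormalisedOff`-literal of ★ `UnramifiedOrbitalUnitFactorPair` §3–§4. [cite: Rogawski1990, §4.3 (p. 43)] -/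
theorem exists_finset_forall_atPoint_pair_eq_one_of_eventually
    (hν : ∀ v, νH v ((cmLocalIntegralLevel L N₂ H₂ v : Set ((cmDatum L N₂ H₂).Local v)) ×ˢ
      (cmLocalIntegralLevel L N₁ H₁ v : Set ((cmDatum L N₁ H₁).Local v))) = 1)
    (hcan : ∀ v, (mH v).IsCanonical (P v) (νH v))
    (y₂ : (cmDatum L N₂ H₂).Adelic) (y₁ : (cmDatum L N₁ H₁).Adelic)
    (hP : ∀ v, P v (Quotient.out (ConjClasses.mk ((cmDatum L N₂ H₂).toLocal v y₂, (cmDatum L N₁ H₁).toLocal v y₁))))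
    (hcc : ∀ᶠ v in cofinite, compactCore (Subgroup.centralizer ({((cmDatum L N₂ H₂).toLocal v y₂, (cmDatum L N₁ H₁).toLocal v y₁)} :
        Set ((cmDatum L N₂ H₂).Local v × (cmDatum L N₁ H₁).Local v))) ⊆
      Subtype.val ⁻¹' ((cmLocalIntegralLevel L N₂ H₂ v : Set ((cmDatum L N₂ H₂).Local v)) ×ˢ
        (cmLocalIntegralLevel L N₁ H₁ v : Set ((cmDatum L N₁ H₁).Local v)))) :
    ∃ S₀ : Finset (HeightOneSpectrum (𝓞 ↥(maximalRealSubfield L))), ∀ v, v ∉ S₀ →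
      (mH v).atPoint ((cmDatum L N₂ H₂).toLocal v y₂, (cmDatum L N₁ H₁).toLocal v y₁)
        ((QuotientGroup.mk : (cmDatum L N₂ H₂).Local v × (cmDatum L N₁ H₁).Local v → _) ''
          ((cmLocalIntegralLevel L N₂ H₂ v : Set ((cmDatum L N₂ H₂).Local v)) ×ˢ
            (cmLocalIntegralLevel L N₁ H₁ v : Set ((cmDatum L N₁ H₁).Local v)))) = 1 := by
  rw [Filter.eventually_cofinite] at hcc
  refine ⟨hcc.toFinset, fun v hv => ?_⟩
  have hv' : compactCore (Subgroup.centralizer ({((cmDatum L N₂ H₂).toLocal v y₂, (cmDatum L N₁ H₁).toLocal v y₁)} :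
        Set ((cmDatum L N₂ H₂).Local v × (cmDatum L N₁ H₁).Local v))) ⊆
      Subtype.val ⁻¹' ((cmLocalIntegralLevel L N₂ H₂ v : Set ((cmDatum L N₂ H₂).Local v)) ×ˢ
        (cmLocalIntegralLevel L N₁ H₁ v : Set ((cmDatum L N₁ H₁).Local v))) := by
    by_contra hnot
    exact hv (hcc.mem_toFinset.2 hnot)
  obtain ⟨hKc, hKo⟩ := isCompact_isOpen_prod_cmLocalIntegralLevel L H₂ H₁ v
  exact (hcan v).atPoint_image_mk_eq_one _ (hP v) ((cmLocalIntegralLevel L N₂ H₂ v).prod (cmLocalIntegralLevel L N₁ H₁ v)) hKo hKc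
    (hν v) hv'

/-- **Mass one at every adelic CONJUGATE on the pair**: if the compact cores at `((y₂)_v, (y₁)_v)` are a.e. in `K₂,v × K₁,v`, then so are those at
`((a y₂ a⁻¹)_v, (b y₁ b⁻¹)_v)` for EVERY adelic `a`, `b` (`a_v ∈ K₂,v`, `b_v ∈ K₁,v` for almost all `v`, ★ `eventually_toLocal_mem_cmLocalIntegralLevel`; ★
`compactCore_centralizer_conj_subset` on the product with `K = K₂,v × K₁,v`), hence the mass-one conclusion at the conjugate. [cite: Rogawski1990, §4.3 (p. 43)] -/
theorem exists_finset_forall_atPoint_pair_eq_one_conj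
    (hν : ∀ v, νH v ((cmLocalIntegralLevel L N₂ H₂ v : Set ((cmDatum L N₂ H₂).Local v)) ×ˢ
      (cmLocalIntegralLevel L N₁ H₁ v : Set ((cmDatum L N₁ H₁).Local v))) = 1)
    (hcan : ∀ v, (mH v).IsCanonical (P v) (νH v))
    (y₂ a : (cmDatum L N₂ H₂).Adelic) (y₁ b : (cmDatum L N₁ H₁).Adelic)
    (hP : ∀ v, P v (Quotient.out (ConjClasses.mk ((cmDatum L N₂ H₂).toLocal v (a * y₂ * a⁻¹), (cmDatum L N₁ H₁).toLocal v (b * y₁ * b⁻¹)))))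
    (hcc : ∀ᶠ v in cofinite, compactCore (Subgroup.centralizer ({((cmDatum L N₂ H₂).toLocal v y₂, (cmDatum L N₁ H₁).toLocal v y₁)} :
        Set ((cmDatum L N₂ H₂).Local v × (cmDatum L N₁ H₁).Local v))) ⊆
      Subtype.val ⁻¹' ((cmLocalIntegralLevel L N₂ H₂ v : Set ((cmDatum L N₂ H₂).Local v)) ×ˢ
        (cmLocalIntegralLevel L N₁ H₁ v : Set ((cmDatum L N₁ H₁).Local v)))) :
    ∃ S₀ : Finset (HeightOneSpectrum (𝓞 ↥(maximalRealSubfield L))), ∀ v, v ∉ S₀ →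
      (mH v).atPoint ((cmDatum L N₂ H₂).toLocal v (a * y₂ * a⁻¹), (cmDatum L N₁ H₁).toLocal v (b * y₁ * b⁻¹))
        ((QuotientGroup.mk : (cmDatum L N₂ H₂).Local v × (cmDatum L N₁ H₁).Local v → _) ''
          ((cmLocalIntegralLevel L N₂ H₂ v : Set ((cmDatum L N₂ H₂).Local v)) ×ˢ
            (cmLocalIntegralLevel L N₁ H₁ v : Set ((cmDatum L N₁ H₁).Local v)))) = 1 := by
  refine exists_finset_forall_atPoint_pair_eq_one_of_eventually L H₂ H₁ P νH mH hν hcan (a * y₂ * a⁻¹) (b * y₁ * b⁻¹) hP ?_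
  filter_upwards [hcc, Rogawski1990.eventually_toLocal_mem_cmLocalIntegralLevel a, Rogawski1990.eventually_toLocal_mem_cmLocalIntegralLevel b]
    with v hv ha hb
  rw [map_mul, map_mul, map_inv, map_mul, map_mul, map_inv]
  have h := compactCore_centralizer_conj_subset ((cmLocalIntegralLevel L N₂ H₂ v).prod (cmLocalIntegralLevel L N₁ H₁ v))
    ((cmDatum L N₂ H₂).toLocal v y₂, (cmDatum L N₁ H₁).toLocal v y₁) ((cmDatum L N₂ H₂).toLocal v a, (cmDatum L N₁ H₁).toLocal v b) ⟨ha, hb⟩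
    (by rw [Subgroup.coe_prod]; exact hv)
  rw [Subgroup.coe_prod] at h
  simpa only [Prod.mk_mul_mk, Prod.inv_mk] using h

/-- **Mass one at every adelic conjugate of a rational regular pair**, FACT-FREE at hermitian non-degenerate `H₂`, `H₁`: for `γ₂ ∈ U(H₂)(L⁺)`, `γ₁ ∈ U(H₁)(L⁺)` regular and
adelic `y₂`, `y₁` conjugate to `toAdelic γ₂`, `toAdelic γ₁` (e.g. the coordinates of `out ⟦(toAdelic γ₂, toAdelic γ₁)⟧`), canonical families are normalised off a finite
set at `(y₂, y₁)` (★ S-H `eventually_compactCore_centralizer_pair_subset` at the rational pair + `…_conj`). [cite: Rogawski1990, §4.3 (p. 43)] [cite: Kottwitz1986, §7] -/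
theorem exists_finset_forall_atPoint_pair_eq_one_of_isConj_toAdelic (hH₂ : (H₂.map (cmConjRingHom L))ᵀ = H₂) (hH₂d : H₂.det ≠ 0)
    (hH₁ : (H₁.map (cmConjRingHom L))ᵀ = H₁) (hH₁d : H₁.det ≠ 0)
    (hν : ∀ v, νH v ((cmLocalIntegralLevel L N₂ H₂ v : Set ((cmDatum L N₂ H₂).Local v)) ×ˢ
      (cmLocalIntegralLevel L N₁ H₁ v : Set ((cmDatum L N₁ H₁).Local v))) = 1)
    (hcan : ∀ v, (mH v).IsCanonical (P v) (νH v))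
    (γ₂ : (cmDatum L N₂ H₂).Rational) (hγ₂ : IsRegularElt (γ₂.val : GL (Fin N₂) L))
    (γ₁ : (cmDatum L N₁ H₁).Rational) (hγ₁ : IsRegularElt (γ₁.val : GL (Fin N₁) L))
    (y₂ : (cmDatum L N₂ H₂).Adelic) (y₁ : (cmDatum L N₁ H₁).Adelic)
    (hy₂ : IsConj ((cmDatum L N₂ H₂).toAdelic γ₂) y₂) (hy₁ : IsConj ((cmDatum L N₁ H₁).toAdelic γ₁) y₁)
    (hP : ∀ v, P v (Quotient.out (ConjClasses.mk ((cmDatum L N₂ H₂).toLocal v y₂, (cmDatum L N₁ H₁).toLocal v y₁)))) :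
    ∃ S₀ : Finset (HeightOneSpectrum (𝓞 ↥(maximalRealSubfield L))), ∀ v, v ∉ S₀ →
      (mH v).atPoint ((cmDatum L N₂ H₂).toLocal v y₂, (cmDatum L N₁ H₁).toLocal v y₁)
        ((QuotientGroup.mk : (cmDatum L N₂ H₂).Local v × (cmDatum L N₁ H₁).Local v → _) ''
          ((cmLocalIntegralLevel L N₂ H₂ v : Set ((cmDatum L N₂ H₂).Local v)) ×ˢ
            (cmLocalIntegralLevel L N₁ H₁ v : Set ((cmDatum L N₁ H₁).Local v)))) = 1 := by
  obtain ⟨a, ha⟩ := isConj_iff.1 hy₂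
  obtain ⟨b, hb⟩ := isConj_iff.1 hy₁
  subst ha hb
  exact exists_finset_forall_atPoint_pair_eq_one_conj L H₂ H₁ P νH mH hν hcan _ a _ b hP
    (eventually_compactCore_centralizer_pair_subset L H₂ H₁ hH₂ hH₂d hH₁ hH₁d γ₂ hγ₂ γ₁ hγ₁)

end Literature.NumberTheory.Automorphic.UnitaryGroup

/-! ## §2 `H = U(Φ₂) × U(Φ₁)`: mass one at every `H`-matching adèle over a rational `γ_H` -/

namespace Literature.NumberTheory.Rogawski1990

open Literature.NumberTheory.Automorphic Literature.NumberTheory.Automorphic.UnitaryGroup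
open Literature.AlgebraicGeometry.ShimuraVarieties (unitaryGroup)

section MatchingH

variable {L : Type} [Field L] [NumberField L] [IsCMField L]
variable {γH : (UnitaryGroup.cmDatum L 2 (Matrix.of fun i j : Fin 2 => if i.val + j.val + 1 = 2 then (1 : L) else 0)).Rational ×
  (UnitaryGroup.cmDatum L 1 (Matrix.of fun i j : Fin 1 => if i.val + j.val + 1 = 1 then (1 : L) else 0)).Rational}
variable
  [∀ (v : HeightOneSpectrum (𝓞 ↥(maximalRealSubfield L))) (x : ((UnitaryGroup.cmDatum L 2 (Matrix.of fun i j : Fin 2 => if i.val + j.val + 1 = 2 then (1 : L) else 0)).Local v ×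
        (UnitaryGroup.cmDatum L 1 (Matrix.of fun i j : Fin 1 => if i.val + j.val + 1 = 1 then (1 : L) else 0)).Local v)),
    MeasurableSpace (((UnitaryGroup.cmDatum L 2 (Matrix.of fun i j : Fin 2 => if i.val + j.val + 1 = 2 then (1 : L) else 0)).Local v ×
        (UnitaryGroup.cmDatum L 1 (Matrix.of fun i j : Fin 1 => if i.val + j.val + 1 = 1 then (1 : L) else 0)).Local v) ⧸ Subgroup.centralizer ({x} : Set ((UnitaryGroup.cmDatum L 2 (Matrix.of fun i j : Fin 2 => if i.val + j.val + 1 = 2 then (1 : L) else 0)).Local v ×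
        (UnitaryGroup.cmDatum L 1 (Matrix.of fun i j : Fin 1 => if i.val + j.val + 1 = 1 then (1 : L) else 0)).Local v)))]
  [∀ (v : HeightOneSpectrum (𝓞 ↥(maximalRealSubfield L))) (x : ((UnitaryGroup.cmDatum L 2 (Matrix.of fun i j : Fin 2 => if i.val + j.val + 1 = 2 then (1 : L) else 0)).Local v ×
        (UnitaryGroup.cmDatum L 1 (Matrix.of fun i j : Fin 1 => if i.val + j.val + 1 = 1 then (1 : L) else 0)).Local v)),
    BorelSpace (((UnitaryGroup.cmDatum L 2 (Matrix.of fun i j : Fin 2 => if i.val + j.val + 1 = 2 then (1 : L) else 0)).Local v ×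
        (UnitaryGroup.cmDatum L 1 (Matrix.of fun i j : Fin 1 => if i.val + j.val + 1 = 1 then (1 : L) else 0)).Local v) ⧸ Subgroup.centralizer ({x} : Set ((UnitaryGroup.cmDatum L 2 (Matrix.of fun i j : Fin 2 => if i.val + j.val + 1 = 2 then (1 : L) else 0)).Local v ×
        (UnitaryGroup.cmDatum L 1 (Matrix.of fun i j : Fin 1 => if i.val + j.val + 1 = 1 then (1 : L) else 0)).Local v)))]
  [∀ v : HeightOneSpectrum (𝓞 ↥(maximalRealSubfield L)), MeasurableSpace ((UnitaryGroup.cmDatum L 2 (Matrix.of fun i j : Fin 2 => if i.val + j.val + 1 = 2 then (1 : L) else 0)).Local v ×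
      (UnitaryGroup.cmDatum L 1 (Matrix.of fun i j : Fin 1 => if i.val + j.val + 1 = 1 then (1 : L) else 0)).Local v)]
  [∀ v : HeightOneSpectrum (𝓞 ↥(maximalRealSubfield L)), BorelSpace ((UnitaryGroup.cmDatum L 2 (Matrix.of fun i j : Fin 2 => if i.val + j.val + 1 = 2 then (1 : L) else 0)).Local v ×
      (UnitaryGroup.cmDatum L 1 (Matrix.of fun i j : Fin 1 => if i.val + j.val + 1 = 1 then (1 : L) else 0)).Local v)]
  (P : ∀ v : HeightOneSpectrum (𝓞 ↥(maximalRealSubfield L)), (UnitaryGroup.cmDatum L 2 (Matrix.of fun i j : Fin 2 => if i.val + j.val + 1 = 2 then (1 : L) else 0)).Local v ×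
      (UnitaryGroup.cmDatum L 1 (Matrix.of fun i j : Fin 1 => if i.val + j.val + 1 = 1 then (1 : L) else 0)).Local v → Prop)
  (νH : ∀ v : HeightOneSpectrum (𝓞 ↥(maximalRealSubfield L)), Measure ((UnitaryGroup.cmDatum L 2 (Matrix.of fun i j : Fin 2 => if i.val + j.val + 1 = 2 then (1 : L) else 0)).Local v ×
      (UnitaryGroup.cmDatum L 1 (Matrix.of fun i j : Fin 1 => if i.val + j.val + 1 = 1 then (1 : L) else 0)).Local v))
  [∀ v, (νH v).IsHaarMeasure] [∀ v, (νH v).IsMulRightInvariant]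
  (mH : ∀ v : HeightOneSpectrum (𝓞 ↥(maximalRealSubfield L)), OrbitalMeasureFamily ((UnitaryGroup.cmDatum L 2 (Matrix.of fun i j : Fin 2 => if i.val + j.val + 1 = 2 then (1 : L) else 0)).Local v ×
      (UnitaryGroup.cmDatum L 1 (Matrix.of fun i j : Fin 1 => if i.val + j.val + 1 = 1 then (1 : L) else 0)).Local v))

/-- **Canonical families on `H_v` are normalised off a finite set at EVERY `H`-matching adèle.**  `mH v` canonical for `(P_v, ν_v)` with `ν_v(K₂,v × K₁,v) = 1`;
`γ_H = (γ₂, γ₁)` rational with `γ₂` regular; the a.e. `K_v`-conjugacy of [Kt₄] Prop. 7.1 for `U(Φ₂)` at `γ₂` as the hypothesis `hP` (★ `AdelicStableOrbitalSupportFiniteH`'s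
shape).  Then for every `p ∈ 𝒪′_st(γ_H ∕ 𝐀)` (★ `MatchingAdeleH`) with `P_v` at its local class representatives there is a finite `S₀` with
`(mH v).atPoint (p_v) (π (K₂,v × K₁,v)) = 1` for all `v ∉ S₀`: `p.adele.2 = toAdelic γ₁` (★ `MatchingAdeleH.adele_snd_eq`); for almost all `v`, `p.adele.1_v ∈ K₂,v` (adelic) so
`p.adele.1_v = k (γ₂)_v k⁻¹` with `k ∈ K₂,v` (`hP`), whence `compactCore Z(p_v) = conj_{(k,1)} '' compactCore Z((γ_H)_v) ⊆ K₂,v × K₁,v` (★ `compactCore_centralizer_conj_subset`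
on the pair + ★ S-H `eventually_compactCore_centralizer_pair_subset`, `γ₁` regular for free ★ `isRegularElt_fin_one`), and §1 applies.
[cite: Rogawski1990, §3.3 p. 21; §4.3 (pp. 43–44)] [cite: Kottwitz1986, Prop. 7.1] -/
theorem MatchingAdeleH.exists_finset_forall_atPoint_eq_one
    (hν : ∀ v, νH v ((UnitaryGroup.cmLocalIntegralLevel L 2 (Matrix.of fun i j : Fin 2 => if i.val + j.val + 1 = 2 then (1 : L) else 0) v :
        Set ((UnitaryGroup.cmDatum L 2 (Matrix.of fun i j : Fin 2 => if i.val + j.val + 1 = 2 then (1 : L) else 0)).Local v)) ×ˢ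
      (UnitaryGroup.cmLocalIntegralLevel L 1 (Matrix.of fun i j : Fin 1 => if i.val + j.val + 1 = 1 then (1 : L) else 0) v :
        Set ((UnitaryGroup.cmDatum L 1 (Matrix.of fun i j : Fin 1 => if i.val + j.val + 1 = 1 then (1 : L) else 0)).Local v))) = 1)
    (hcan : ∀ v, (mH v).IsCanonical (P v) (νH v))
    (hreg : IsRegularElt ((γH.1 : unitaryGroup (cmConjRingHom L) (Matrix.of fun i j : Fin 2 => if i.val + j.val + 1 = 2 then (1 : L) else 0)).val : GL (Fin 2) L))
    (hP : ∀ᶠ v in cofinite, ∀ g : (UnitaryGroup.cmDatum L 2 (Matrix.of fun i j : Fin 2 => if i.val + j.val + 1 = 2 then (1 : L) else 0)).Local v,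
      g ∈ UnitaryGroup.cmLocalIntegralLevel L 2 (Matrix.of fun i j : Fin 2 => if i.val + j.val + 1 = 2 then (1 : L) else 0) v →
        IsStablyConj (UnitaryGroup.conjLocal L (IsCMField.complexConj L) v) ((UnitaryGroup.adelicForm L 2 (Matrix.of fun i j : Fin 2 => if i.val + j.val + 1 = 2 then (1 : L) else 0)).map (UnitaryGroup.adeleToLocal L v))
            ((UnitaryGroup.cmDatum L 2 (Matrix.of fun i j : Fin 2 => if i.val + j.val + 1 = 2 then (1 : L) else 0)).toLocal v ((UnitaryGroup.cmDatum L 2 (Matrix.of fun i j : Fin 2 => if i.val + j.val + 1 = 2 then (1 : L) else 0)).toAdelic γH.1)) g →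
          ∃ k ∈ UnitaryGroup.cmLocalIntegralLevel L 2 (Matrix.of fun i j : Fin 2 => if i.val + j.val + 1 = 2 then (1 : L) else 0) v,
            k * (UnitaryGroup.cmDatum L 2 (Matrix.of fun i j : Fin 2 => if i.val + j.val + 1 = 2 then (1 : L) else 0)).toLocal v ((UnitaryGroup.cmDatum L 2 (Matrix.of fun i j : Fin 2 => if i.val + j.val + 1 = 2 then (1 : L) else 0)).toAdelic γH.1) * k⁻¹ = g)
    (p : MatchingAdeleH L γH)
    (hPp : ∀ v, P v (Quotient.out (ConjClasses.mk
      ((UnitaryGroup.cmDatum L 2 (Matrix.of fun i j : Fin 2 => if i.val + j.val + 1 = 2 then (1 : L) else 0)).toLocal v p.adele.1,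
        (UnitaryGroup.cmDatum L 1 (Matrix.of fun i j : Fin 1 => if i.val + j.val + 1 = 1 then (1 : L) else 0)).toLocal v p.adele.2)))) :
    ∃ S₀ : Finset (HeightOneSpectrum (𝓞 ↥(maximalRealSubfield L))), ∀ v, v ∉ S₀ →
      (mH v).atPoint ((UnitaryGroup.cmDatum L 2 (Matrix.of fun i j : Fin 2 => if i.val + j.val + 1 = 2 then (1 : L) else 0)).toLocal v p.adele.1,
          (UnitaryGroup.cmDatum L 1 (Matrix.of fun i j : Fin 1 => if i.val + j.val + 1 = 1 then (1 : L) else 0)).toLocal v p.adele.2)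
        ((QuotientGroup.mk : (UnitaryGroup.cmDatum L 2 (Matrix.of fun i j : Fin 2 => if i.val + j.val + 1 = 2 then (1 : L) else 0)).Local v ×
            (UnitaryGroup.cmDatum L 1 (Matrix.of fun i j : Fin 1 => if i.val + j.val + 1 = 1 then (1 : L) else 0)).Local v → _) ''
          ((UnitaryGroup.cmLocalIntegralLevel L 2 (Matrix.of fun i j : Fin 2 => if i.val + j.val + 1 = 2 then (1 : L) else 0) v :
              Set ((UnitaryGroup.cmDatum L 2 (Matrix.of fun i j : Fin 2 => if i.val + j.val + 1 = 2 then (1 : L) else 0)).Local v)) ×ˢ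
            (UnitaryGroup.cmLocalIntegralLevel L 1 (Matrix.of fun i j : Fin 1 => if i.val + j.val + 1 = 1 then (1 : L) else 0) v :
              Set ((UnitaryGroup.cmDatum L 1 (Matrix.of fun i j : Fin 1 => if i.val + j.val + 1 = 1 then (1 : L) else 0)).Local v)))) = 1 := by
  refine UnitaryGroup.exists_finset_forall_atPoint_pair_eq_one_of_eventually L _ _ P νH mH hν hcan p.adele.1 p.adele.2 hPp ?_
  -- compact cores at the rational pair are small a.e. (fact-free), and `p_v` is a `K_{H,v}`-conjugate of `(γ_H)_v` a.e.
  filter_upwards [UnitaryGroup.eventually_compactCore_centralizer_pair_subset L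
      (Matrix.of fun i j : Fin 2 => if i.val + j.val + 1 = 2 then (1 : L) else 0) (Matrix.of fun i j : Fin 1 => if i.val + j.val + 1 = 1 then (1 : L) else 0)
      (UnitaryGroup.antidiagOne_isHermitian L 2) (UnitaryGroup.isUnit_antidiagOne_det L 2).ne_zero
      (UnitaryGroup.antidiagOne_isHermitian L 1) (UnitaryGroup.isUnit_antidiagOne_det L 1).ne_zero γH.1 hreg γH.2 (isRegularElt_fin_one _),
    hP, eventually_toLocal_mem_cmLocalIntegralLevel p.adele.1] with v hcc hPv hint
  obtain ⟨k, hk, hkp⟩ := hPv _ hint (p.isLocalStablyConjH v).1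
  have h2 : (UnitaryGroup.cmDatum L 1 (Matrix.of fun i j : Fin 1 => if i.val + j.val + 1 = 1 then (1 : L) else 0)).toLocal v p.adele.2 =
      (UnitaryGroup.cmDatum L 1 (Matrix.of fun i j : Fin 1 => if i.val + j.val + 1 = 1 then (1 : L) else 0)).toLocal v
        ((UnitaryGroup.cmDatum L 1 (Matrix.of fun i j : Fin 1 => if i.val + j.val + 1 = 1 then (1 : L) else 0)).toAdelic γH.2) := by
    rw [p.adele_snd_eq]
  have h := compactCore_centralizer_conj_subset
    ((UnitaryGroup.cmLocalIntegralLevel L 2 (Matrix.of fun i j : Fin 2 => if i.val + j.val + 1 = 2 then (1 : L) else 0) v).prod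
      (UnitaryGroup.cmLocalIntegralLevel L 1 (Matrix.of fun i j : Fin 1 => if i.val + j.val + 1 = 1 then (1 : L) else 0) v))
    ((UnitaryGroup.cmDatum L 2 (Matrix.of fun i j : Fin 2 => if i.val + j.val + 1 = 2 then (1 : L) else 0)).toLocal v
        ((UnitaryGroup.cmDatum L 2 (Matrix.of fun i j : Fin 2 => if i.val + j.val + 1 = 2 then (1 : L) else 0)).toAdelic γH.1),
      (UnitaryGroup.cmDatum L 1 (Matrix.of fun i j : Fin 1 => if i.val + j.val + 1 = 1 then (1 : L) else 0)).toLocal v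
        ((UnitaryGroup.cmDatum L 1 (Matrix.of fun i j : Fin 1 => if i.val + j.val + 1 = 1 then (1 : L) else 0)).toAdelic γH.2))
    (k, 1) ⟨hk, one_mem _⟩ (by rw [Subgroup.coe_prod]; exact hcc)
  rw [Subgroup.coe_prod] at h
  have hpair : ((k, (1 : (UnitaryGroup.cmDatum L 1 (Matrix.of fun i j : Fin 1 => if i.val + j.val + 1 = 1 then (1 : L) else 0)).Local v)) *
        ((UnitaryGroup.cmDatum L 2 (Matrix.of fun i j : Fin 2 => if i.val + j.val + 1 = 2 then (1 : L) else 0)).toLocal v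
            ((UnitaryGroup.cmDatum L 2 (Matrix.of fun i j : Fin 2 => if i.val + j.val + 1 = 2 then (1 : L) else 0)).toAdelic γH.1),
          (UnitaryGroup.cmDatum L 1 (Matrix.of fun i j : Fin 1 => if i.val + j.val + 1 = 1 then (1 : L) else 0)).toLocal v
            ((UnitaryGroup.cmDatum L 1 (Matrix.of fun i j : Fin 1 => if i.val + j.val + 1 = 1 then (1 : L) else 0)).toAdelic γH.2)) *
        (k, (1 : (UnitaryGroup.cmDatum L 1 (Matrix.of fun i j : Fin 1 => if i.val + j.val + 1 = 1 then (1 : L) else 0)).Local v))⁻¹) =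
      ((UnitaryGroup.cmDatum L 2 (Matrix.of fun i j : Fin 2 => if i.val + j.val + 1 = 2 then (1 : L) else 0)).toLocal v p.adele.1,
        (UnitaryGroup.cmDatum L 1 (Matrix.of fun i j : Fin 1 => if i.val + j.val + 1 = 1 then (1 : L) else 0)).toLocal v p.adele.2) := by
    rw [h2]
    ext
    · simpa only [Prod.fst_mul, Prod.fst_inv] using hkp
    · simp only [Prod.snd_mul, Prod.snd_inv, inv_one, mul_one, one_mul]
  rw [hpair] at h
  exact h

/-- **… and at every representative of a class of `𝒞′_𝐀(γ_H)`** (saturation ★ `exists_matchingAdeleH_adele_eq_of_mem`): for `c ∈ adelicStableClassesOverH L γH` and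
`[h] = c` (e.g. `h = out c`, the representative the «C-H» family `ofLocalAdelicH mH mHi c` is built at), canonical families are normalised off a finite set at `h`
— the normalisability guard of the SJ_H Euler socket at every class it sums over. [cite: Rogawski1990, §4.3 (pp. 43–44); §5.4 p. 72] [cite: Kottwitz1986, Prop. 7.1] -/
theorem MatchingAdeleH.exists_finset_forall_atPoint_eq_one_of_mem_classes
    (hν : ∀ v, νH v ((UnitaryGroup.cmLocalIntegralLevel L 2 (Matrix.of fun i j : Fin 2 => if i.val + j.val + 1 = 2 then (1 : L) else 0) v :
        Set ((UnitaryGroup.cmDatum L 2 (Matrix.of fun i j : Fin 2 => if i.val + j.val + 1 = 2 then (1 : L) else 0)).Local v)) ×ˢ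
      (UnitaryGroup.cmLocalIntegralLevel L 1 (Matrix.of fun i j : Fin 1 => if i.val + j.val + 1 = 1 then (1 : L) else 0) v :
        Set ((UnitaryGroup.cmDatum L 1 (Matrix.of fun i j : Fin 1 => if i.val + j.val + 1 = 1 then (1 : L) else 0)).Local v))) = 1)
    (hcan : ∀ v, (mH v).IsCanonical (P v) (νH v))
    (hreg : IsRegularElt ((γH.1 : unitaryGroup (cmConjRingHom L) (Matrix.of fun i j : Fin 2 => if i.val + j.val + 1 = 2 then (1 : L) else 0)).val : GL (Fin 2) L))
    (hP : ∀ᶠ v in cofinite, ∀ g : (UnitaryGroup.cmDatum L 2 (Matrix.of fun i j : Fin 2 => if i.val + j.val + 1 = 2 then (1 : L) else 0)).Local v,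
      g ∈ UnitaryGroup.cmLocalIntegralLevel L 2 (Matrix.of fun i j : Fin 2 => if i.val + j.val + 1 = 2 then (1 : L) else 0) v →
        IsStablyConj (UnitaryGroup.conjLocal L (IsCMField.complexConj L) v) ((UnitaryGroup.adelicForm L 2 (Matrix.of fun i j : Fin 2 => if i.val + j.val + 1 = 2 then (1 : L) else 0)).map (UnitaryGroup.adeleToLocal L v))
            ((UnitaryGroup.cmDatum L 2 (Matrix.of fun i j : Fin 2 => if i.val + j.val + 1 = 2 then (1 : L) else 0)).toLocal v ((UnitaryGroup.cmDatum L 2 (Matrix.of fun i j : Fin 2 => if i.val + j.val + 1 = 2 then (1 : L) else 0)).toAdelic γH.1)) g →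
          ∃ k ∈ UnitaryGroup.cmLocalIntegralLevel L 2 (Matrix.of fun i j : Fin 2 => if i.val + j.val + 1 = 2 then (1 : L) else 0) v,
            k * (UnitaryGroup.cmDatum L 2 (Matrix.of fun i j : Fin 2 => if i.val + j.val + 1 = 2 then (1 : L) else 0)).toLocal v ((UnitaryGroup.cmDatum L 2 (Matrix.of fun i j : Fin 2 => if i.val + j.val + 1 = 2 then (1 : L) else 0)).toAdelic γH.1) * k⁻¹ = g)
    {c : ConjClasses ((UnitaryGroup.cmDatum L 2 (Matrix.of fun i j : Fin 2 => if i.val + j.val + 1 = 2 then (1 : L) else 0)).Adelic ×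
      (UnitaryGroup.cmDatum L 1 (Matrix.of fun i j : Fin 1 => if i.val + j.val + 1 = 1 then (1 : L) else 0)).Adelic)}
    (hc : c ∈ adelicStableClassesOverH L γH)
    {h : (UnitaryGroup.cmDatum L 2 (Matrix.of fun i j : Fin 2 => if i.val + j.val + 1 = 2 then (1 : L) else 0)).Adelic ×
      (UnitaryGroup.cmDatum L 1 (Matrix.of fun i j : Fin 1 => if i.val + j.val + 1 = 1 then (1 : L) else 0)).Adelic}
    (hh : ConjClasses.mk h = c)
    (hPh : ∀ v, P v (Quotient.out (ConjClasses.mk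
      ((UnitaryGroup.cmDatum L 2 (Matrix.of fun i j : Fin 2 => if i.val + j.val + 1 = 2 then (1 : L) else 0)).toLocal v h.1,
        (UnitaryGroup.cmDatum L 1 (Matrix.of fun i j : Fin 1 => if i.val + j.val + 1 = 1 then (1 : L) else 0)).toLocal v h.2)))) :
    ∃ S₀ : Finset (HeightOneSpectrum (𝓞 ↥(maximalRealSubfield L))), ∀ v, v ∉ S₀ →
      (mH v).atPoint ((UnitaryGroup.cmDatum L 2 (Matrix.of fun i j : Fin 2 => if i.val + j.val + 1 = 2 then (1 : L) else 0)).toLocal v h.1,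
          (UnitaryGroup.cmDatum L 1 (Matrix.of fun i j : Fin 1 => if i.val + j.val + 1 = 1 then (1 : L) else 0)).toLocal v h.2)
        ((QuotientGroup.mk : (UnitaryGroup.cmDatum L 2 (Matrix.of fun i j : Fin 2 => if i.val + j.val + 1 = 2 then (1 : L) else 0)).Local v ×
            (UnitaryGroup.cmDatum L 1 (Matrix.of fun i j : Fin 1 => if i.val + j.val + 1 = 1 then (1 : L) else 0)).Local v → _) ''
          ((UnitaryGroup.cmLocalIntegralLevel L 2 (Matrix.of fun i j : Fin 2 => if i.val + j.val + 1 = 2 then (1 : L) else 0) v :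
              Set ((UnitaryGroup.cmDatum L 2 (Matrix.of fun i j : Fin 2 => if i.val + j.val + 1 = 2 then (1 : L) else 0)).Local v)) ×ˢ
            (UnitaryGroup.cmLocalIntegralLevel L 1 (Matrix.of fun i j : Fin 1 => if i.val + j.val + 1 = 1 then (1 : L) else 0) v :
              Set ((UnitaryGroup.cmDatum L 1 (Matrix.of fun i j : Fin 1 => if i.val + j.val + 1 = 1 then (1 : L) else 0)).Local v)))) = 1 := by
  obtain ⟨q, hq⟩ := exists_matchingAdeleH_adele_eq_of_mem hc hh
  subst hq
  exact MatchingAdeleH.exists_finset_forall_atPoint_eq_one P νH mH hν hcan hreg hP q hPh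

end MatchingH

end Literature.NumberTheory.Rogawski1990

end
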